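import Mathlib.Combinatorics.SimpleGraph.Sum
import Literature.Probability.Percolation.QSMExploration
import Literature.Probability.Percolation.RussoFormula
import HarnessLib

/-!
# The `(p, p^T)` column model as bond percolation on `ℋ_n` with pendant mark edges
# (the `ℋ`-side of Martineau–Severo 2019, Proposition 4.1)

Fifth file of the inline proof of `Literature.Probability.Percolation.martineauSevero_zd3_slabTorus`.
The exploration of `QSMExploration.lean` is run here "on `ℋ`": the coins are the edges of the
auxiliary graph `GI n T = ℋ_n ⊔ (a star with T rays over every column y ∈ ℤ²)`, an `ℋ`-edge
query reads the copy of that edge, and the bonus query of the column `y` reads the `T` rays of its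
star — so the column is marked (`α_y = 1`) with probability `s = p^T`, independently of the bond
configuration. Contents:

* bookkeeping on the state machine valid for every encoding: the specifications of the next query
  (`nq_edge_spec`, `nq_col_spec`, `nq_eq_none_iff`), the halting bound (`nq_stateOf_bt_eq_none`:
  after `N = |E_L| + |box L| + 1` steps the machine has halted, since every productive step
  enlarges `Q` or `Y`), and a freshness criterion (`goodEnc_of_used`);
* `SlabTorus.GI`, `SlabTorus.encI`, `SlabTorus.goodEnc_I` — the `ℋ`-side instance;
* **exploration correctness** (`SlabTorus.reachState_iff_reaches`): along a run, once halted, the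
  explored set is exactly the column-enhanced cluster `Cl_L(ω_ℋ, α)` of the decoded configuration
  (Martineau–Severo, §5: "`C_∞` … is the cluster of the origin of `((∨_k ω_{e,k})_e, α)`"), so the
  transcript event "a column of sup-norm `L+1` was explored" is the event `𝓔_L`;
* **the identification with the polynomial** (`SlabTorus.measureReal_decode_ev`):
  `P_{GI, p}(𝓔_L ∘ decode) = Θ_L(p, p^T)` (cylinder formula `Russo.measureReal_eq_cylPoly` and the
  factorisation of the star blocks), and `SlabTorus.theta_le_theta_zero`:
  `θ_{ℋ_n}(o, p) ≤ Θ_L(p, 0)` (an infinite open cluster reaches sup-norm `L + 1` using open edges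
  only).

## References

* S. Martineau, F. Severo, Ann. Probab. 47 (2019), §4 (`ℙ_{p,s}`), §5 (Step ∞: "By construction,
  `C_∞` has the distribution of the cluster of the origin for the `(p,s)`-process on `ℋ`")
  [MartineauSevero2019].
* L. Russo, Z. Wahrsch. verw. Gebiete 56 (1981), §4 (cylinder probabilities are polynomials).
-/

-- `DecidableEq (Sym2 (Vert n ⊕ (Site 2 × ℕ)))` is a genuine but large instance term (> 128 nodes);
-- raise the tabled-resolution answer size so that `Finset.filter`/membership on coin sets elaborate.
set_option synthInstance.maxSize 1024

namespace Literature.Probability.Percolation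

open LatticeModels MeasureTheory ProbeHistory
open scoped ENNReal

namespace SlabTorus

variable {n : ℕ}

section Machine

open scoped Classical

variable [NeZero n]

/-! ### Specifications of the state machine -/

/-- What an edge query guarantees: queried from an explored endpoint, an edge of `E_L`, not queried
before. [cite: MartineauSevero2019, §5 (Step 2K+1)] -/
theorem nq_edge_spec {L : ℕ} {σ : HState n} {a : Vert n} {d : Dir} (h : nq L σ = some (Query.edge a d)) :
    a ∈ σ.A ∧ s(a, nbr a d) ∈ KE n L ∧ s(a, nbr a d) ∉ σ.Q := by
  unfold nq at h
  split_ifs at h with h1 h2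
  · simp only [Option.some.injEq, Query.edge.injEq] at h
    obtain ⟨rfl, rfl⟩ := h
    exact h1.choose_spec
  · simp at h

/-- What a column query guarantees: no edge query was available, the column lies in `box L`, its
bonus was not attempted, and it is explored-open. [cite: MartineauSevero2019, §5 (Step 2K+2)] -/
theorem nq_col_spec {L : ℕ} {σ : HState n} {y : Site 2} (h : nq L σ = some (Query.col y)) :
    (¬ ∃ q : Vert n × Dir, q.1 ∈ σ.A ∧ s(q.1, nbr q.1 q.2) ∈ KE n L ∧ s(q.1, nbr q.1 q.2) ∉ σ.Q) ∧
      y ∈ box 2 L ∧ y ∉ σ.Y ∧ colOpen σ y := by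
  unfold nq at h
  split_ifs at h with h1 h2
  · simp at h
  · simp only [Option.some.injEq, Query.col.injEq] at h
    subst h
    exact ⟨h1, h2.choose_spec⟩

/-- The machine halts iff every edge of `E_L` at an explored vertex is queried and every explored-open
column of `box L` has had its bonus attempted. [cite: MartineauSevero2019, §5] -/
theorem nq_eq_none_iff {L : ℕ} {σ : HState n} :
    nq L σ = none ↔ (∀ a ∈ σ.A, ∀ d : Dir, s(a, nbr a d) ∈ KE n L → s(a, nbr a d) ∈ σ.Q) ∧
      (∀ y ∈ box 2 L, colOpen σ y → y ∈ σ.Y) := by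
  unfold nq
  split_ifs with h1 h2
  · constructor
    · intro h; cases h
    · rintro ⟨hall, -⟩
      obtain ⟨⟨a, d⟩, ha, he, hQ⟩ := h1
      exact absurd (hall a ha d he) hQ
  · constructor
    · intro h; cases h
    · rintro ⟨-, hall⟩
      obtain ⟨y, hy, hY, hopen⟩ := h2
      exact absurd (hall y hy hopen) hY
  · simp only [true_iff]
    exact ⟨fun a ha d he => by_contra fun hQ => h1 ⟨(a, d), ha, he, hQ⟩,
      fun y hy hopen => by_contra fun hY => h2 ⟨y, hy, hY, hopen⟩⟩

/-- Once halted, the replayed state is frozen. [folklore] -/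
theorem stateOf_cons_of_none {L : ℕ} {b : List Bool} (h : nq L (stateOf (n := n) L b) = none) (a : Bool) :
    stateOf (n := n) L (a :: b) = stateOf L b := by
  rw [stateOf_cons, h]

/-- A productive step. [folklore] -/
theorem stateOf_cons_of_some {L : ℕ} {b : List Bool} {q : Query n} (h : nq L (stateOf (n := n) L b) = some q) (a : Bool) :
    stateOf (n := n) L (a :: b) = hstep (stateOf L b) q a := by
  rw [stateOf_cons, h]

/-- The potential `|Q| + |Y|` grows by one at every productive step. [folklore] -/
theorem card_hstep {L : ℕ} {σ : HState n} {q : Query n} (h : nq L σ = some q) (a : Bool) :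
    (hstep σ q a).Q.card + (hstep σ q a).Y.card = σ.Q.card + σ.Y.card + 1 := by
  cases q with
  | edge a' d =>
    obtain ⟨-, -, hQ⟩ := nq_edge_spec h
    simp [hstep, Finset.card_insert_of_notMem hQ]
    omega
  | col y =>
    obtain ⟨-, -, hY, -⟩ := nq_col_spec h
    simp [hstep, Finset.card_insert_of_notMem hY]
    omega

/-- Queried edges lie in `E_L` and attempted columns in `box L`, for every transcript. [folklore] -/
theorem Q_subset_Y_subset (L : ℕ) (b : List Bool) :
    (stateOf (n := n) L b).Q ⊆ KE n L ∧ (stateOf (n := n) L b).Y ⊆ box 2 L := by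
  induction b with
  | nil => simp [stateOf, HState.init]
  | cons a b ih =>
    rw [stateOf_cons]
    cases hq : nq L (stateOf (n := n) L b) with
    | none => exact ih
    | some q =>
      cases q with
      | edge a' d =>
        obtain ⟨-, he, -⟩ := nq_edge_spec hq
        simp only [hstep]
        exact ⟨Finset.insert_subset he ih.1, ih.2⟩
      | col y =>
        obtain ⟨-, hy, -, -⟩ := nq_col_spec hq
        simp only [hstep]
        exact ⟨ih.1, Finset.insert_subset hy ih.2⟩

/-- If the machine has not halted after the transcript `b`, then every step of `b` was productive and
`|b| ≤ |Q| + |Y|`. [folklore] -/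
theorem length_le_of_nq_ne_none (L : ℕ) (b : List Bool) (h : nq L (stateOf (n := n) L b) ≠ none) :
    b.length ≤ (stateOf (n := n) L b).Q.card + (stateOf (n := n) L b).Y.card := by
  induction b with
  | nil => simp
  | cons a b ih =>
    cases hq : nq L (stateOf (n := n) L b) with
    | none => exact absurd (by rw [stateOf_cons_of_none hq]; exact hq) h
    | some q =>
      rw [stateOf_cons_of_some hq, card_hstep hq, List.length_cons]
      have := ih (by rw [hq]; simp)
      omega

/-- **Halting bound**: after any transcript `b` of length `> |E_L| + |box L|` the machine has halted.
[cite: MartineauSevero2019, §5 ("after finitely … many iterations")] -/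
theorem nq_eq_none_of_length (L : ℕ) (b : List Bool) (hb : (KE n L).card + (box 2 L).card < b.length) :
    nq L (stateOf (n := n) L b) = none := by
  by_contra h
  have h1 := length_le_of_nq_ne_none L b h
  have h2 := Q_subset_Y_subset (n := n) L b
  have := Finset.card_le_card h2.1
  have := Finset.card_le_card h2.2
  omega

section Halting

variable {W : Type*} {L T : ℕ} {enc : List Bool → Query n → Finset (Sym2 W)} {G : SimpleGraph W}

/-- Along a run, as long as the machine has not halted, the transcript after `k` steps has length `k`.
[folklore] -/
theorem length_bt_hist (hE : GoodEnc (n := n) L T enc G) (k : ℕ) (ω : BondConfig W)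
    (h : nq L (stateOf (n := n) L (bt ((texpl L enc).hist k ω))) ≠ none) : (bt ((texpl L enc).hist k ω)).length = k := by
  induction k with
  | zero => simp
  | succ k ih =>
    have hrec := bt_hist_succ_eq hE k ω
    cases hw : wanted L enc (bt ((texpl L enc).hist k ω)) with
    | none =>
      rw [hw] at hrec
      simp only at hrec
      rw [hrec] at h
      exact absurd ((wanted_eq_none_iff L enc _).1 hw) h
    | some D =>
      rw [hw] at hrec
      simp only at hrec
      have hk : nq L (stateOf (n := n) L (bt ((texpl L enc).hist k ω))) ≠ none := fun h0 => by
        rw [(wanted_eq_none_iff L enc _).2 h0] at hw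
        cases hw
      rw [hrec, List.length_cons, ih hk]

/-- **The exploration has halted at time `N = |E_L| + |box L| + 1`.** [cite: MartineauSevero2019, §5] -/
theorem nq_stateOf_bt_eq_none (hE : GoodEnc (n := n) L T enc G) (k : ℕ) (hk : (KE n L).card + (box 2 L).card < k)
    (ω : BondConfig W) : nq L (stateOf (n := n) L (bt ((texpl L enc).hist k ω))) = none := by
  by_contra h
  have hlen := length_bt_hist hE k ω h
  exact h (nq_eq_none_of_length L _ (by rw [hlen]; exact hk))

end Halting

/-! ### A freshness criterion -/

section Used

variable {W : Type*} (L T : ℕ) (enc : List Bool → Query n → Finset (Sym2 W)) (G : SimpleGraph W)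
  (used : List Bool → Finset (Sym2 W))

/-- **Freshness from a bookkeeping of used coins.** If `used b ⊇` the coins probed along the
transcript `b` (it absorbs each probe and never shrinks) and the wanted probe after `b` avoids
`used b`, then the encoding is good. [cite: MartineauSevero2019, §5 (Conditions 1–4)] -/
theorem goodEnc_of_used
    (hsub : ∀ b q, nq L (stateOf (n := n) L b) = some q → (↑(enc b q) : Set (Sym2 W)) ⊆ G.edgeSet)
    (hcard : ∀ b q, nq L (stateOf (n := n) L b) = some q → (enc b q).card = qsize T q)
    (hgrow : ∀ b q a, nq L (stateOf (n := n) L b) = some q → enc b q ∪ used b ⊆ used (a :: b))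
    (hdisj : ∀ b q, nq L (stateOf (n := n) L b) = some q → Disjoint (enc b q) (used b)) :
    GoodEnc (n := n) L T enc G := by
  have hsupp : ∀ (k : ℕ) (ω : BondConfig W), supp ((texpl L enc).hist k ω) ⊆ used (bt ((texpl L enc).hist k ω)) := by
    intro k ω
    induction k with
    | zero => simp
    | succ k ih =>
      rw [Explorer.hist_succ]
      cases hD : (texpl L enc).next ((texpl L enc).hist k ω) with
      | none =>
        rw [Explorer.step_of_none _ hD, supp_cons_none, bt_cons_none]
        exact ih
      | some D =>
        rw [Explorer.step_of_some _ hD, supp_cons_some, bt_cons_some]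
        have hc := ((texpl_next_eq_some_iff L enc).1 hD).1
        change wanted L enc (bt ((texpl L enc).hist k ω)) = some D at hc
        unfold wanted at hc
        cases hq : nq L (stateOf (n := n) L (bt ((texpl L enc).hist k ω))) with
        | none => rw [hq] at hc; cases hc
        | some q =>
          rw [hq] at hc
          simp only [Option.map_some, Option.some.injEq] at hc
          subst hc
          exact (Finset.union_subset_union le_rfl ih).trans (hgrow _ q _ hq)
  refine ⟨hsub, hcard, fun k ω D hc => ?_⟩
  change wanted L enc (bt ((texpl L enc).hist k ω)) = some D at hc
  unfold wanted at hc
  cases hq : nq L (stateOf (n := n) L (bt ((texpl L enc).hist k ω))) with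
  | none => rw [hq] at hc; cases hc
  | some q =>
    rw [hq] at hc
    simp only [Option.map_some, Option.some.injEq] at hc
    subst hc
    exact Finset.disjoint_of_subset_right (hsupp k ω) (hdisj _ q hq)

end Used

end Machine

/-! ### The auxiliary graph: `ℋ_n` with a `T`-ray star over every column -/

/-- The vertex type of the auxiliary graph: a vertex of `ℋ_n`, or the `j`-th vertex of the star of the
column `y` (`j = 0` the centre, `j = 1, …, T` the tips). [folklore] -/
abbrev VI (n : ℕ) : Type := Vert n ⊕ (Site 2 × ℕ)

/-- The star graph over the columns: centre `(y, 0)` joined to the tips `(y, j)`, `1 ≤ j ≤ T`.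
[folklore] -/
def starGraph (T : ℕ) : SimpleGraph (Site 2 × ℕ) :=
  SimpleGraph.fromRel fun a b => a.1 = b.1 ∧ a.2 = 0 ∧ 0 < b.2 ∧ b.2 ≤ T

/-- **The auxiliary graph `GI n T = ℋ_n ⊔ stars`**, whose Bernoulli bond percolation at parameter `p`
realises the `(p, p^T)` column model: `ℋ`-edges are the bonds, a column is marked iff all `T` rays
of its star are open. [cite: MartineauSevero2019, §4 (ℙ_{p,s} with s = p^T)] -/
def GI (n T : ℕ) : SimpleGraph (VI n) := (slabTorusGraph n) ⊕g (starGraph T)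

/-- The copy in `GI` of an `ℋ`-edge. [folklore] -/
def ιE (e : Sym2 (Vert n)) : Sym2 (VI n) := e.map Sum.inl

/-- `ιE` is injective. [folklore] -/
theorem ιE_injective : Function.Injective (ιE (n := n)) := Sym2.map.injective Sum.inl_injective

/-- The `j`-th ray of the star of column `y`. [folklore] -/
def ray (y : Site 2) (j : ℕ) : Sym2 (VI n) := s(Sum.inr (y, 0), Sum.inr (y, j + 1))

/-- The `T` rays of the star of column `y`. [folklore] -/
def stars (T : ℕ) (y : Site 2) : Finset (Sym2 (VI n)) := (Finset.range T).image (ray y)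

/-- Rays are distinct. [folklore] -/
theorem ray_injective (y : Site 2) : Function.Injective (ray (n := n) y) := by
  intro j j' h
  simp only [ray, Sym2.eq_iff, Sum.inr.injEq, Prod.mk.injEq] at h
  omega

/-- A star has `T` rays. [folklore] -/
theorem card_stars (T : ℕ) (y : Site 2) : (stars (n := n) T y).card = T := by
  rw [stars, Finset.card_image_of_injective _ (ray_injective y), Finset.card_range]

/-- Membership in `stars`. [folklore] -/
theorem mem_stars_iff {T : ℕ} {y : Site 2} {f : Sym2 (VI n)} : f ∈ stars T y ↔ ∃ j < T, f = ray y j := by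
  simp [stars, eq_comm]

/-- Copies of `ℋ`-edges of the graph are edges of `GI`. [folklore] -/
theorem ιE_mem_edgeSet {T : ℕ} {e : Sym2 (Vert n)} (he : e ∈ (slabTorusGraph n).edgeSet) : ιE e ∈ (GI n T).edgeSet := by
  induction e using Sym2.ind with
  | _ a b =>
    simp only [ιE, Sym2.map_mk, GI, SimpleGraph.mem_edgeSet, SimpleGraph.sum_adj_inl]
    exact he

/-- Rays are edges of `GI`. [folklore] -/
theorem ray_mem_edgeSet {T : ℕ} (y : Site 2) {j : ℕ} (hj : j < T) : ray y j ∈ (GI n T).edgeSet := by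
  rw [ray, GI, SimpleGraph.mem_edgeSet, SimpleGraph.sum_adj_inr, starGraph, SimpleGraph.fromRel_adj]
  refine ⟨by simp, Or.inl ⟨rfl, rfl, Nat.succ_pos j, hj⟩⟩

/-- A copy of an `ℋ`-edge is not a ray. [folklore] -/
theorem ιE_ne_ray (e : Sym2 (Vert n)) (y : Site 2) (j : ℕ) : ιE e ≠ ray y j := by
  induction e using Sym2.ind with
  | _ a b => simp [ιE, ray]

/-- Rays of distinct columns are distinct. [folklore] -/
theorem ray_ne_ray {y y' : Site 2} (h : y ≠ y') (j j' : ℕ) : ray (n := n) y j ≠ ray y' j' := by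
  intro hh
  rw [ray, ray, Sym2.eq_iff] at hh
  rcases hh with ⟨h1, -⟩ | ⟨h1, -⟩
  · exact h (congrArg Prod.fst (Sum.inr_injective h1))
  · exact h (congrArg Prod.fst (Sum.inr_injective h1))

/-- Stars of distinct columns are disjoint. [folklore] -/
theorem disjoint_stars (T : ℕ) {y y' : Site 2} (h : y ≠ y') : Disjoint (stars (n := n) T y) (stars T y') := by
  rw [Finset.disjoint_left]
  intro f hf hf'
  obtain ⟨j, -, rfl⟩ := mem_stars_iff.1 hf
  obtain ⟨j', -, hj'⟩ := mem_stars_iff.1 hf'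
  exact ray_ne_ray h j j' hj'

/-! ### The `ℋ`-side encoding and its freshness -/

section EncI

variable [NeZero n]

/-- **The `ℋ`-side encoding**: an edge query reads the copy of the `ℋ`-edge, the bonus of `y` reads
the `T` rays of its star. [cite: MartineauSevero2019, §5 (exploration on ℋ)] -/
noncomputable def encI (T : ℕ) : List Bool → Query n → Finset (Sym2 (VI n))
  | _, Query.edge a d => {ιE s(a, nbr a d)}
  | _, Query.col y => stars T y

/-- The coins used along a transcript on the `ℋ` side: copies of queried edges and stars of attempted
columns. [folklore] -/
noncomputable def usedI (L T : ℕ) (b : List Bool) : Finset (Sym2 (VI n)) :=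
  (stateOf (n := n) L b).Q.image ιE ∪ (stateOf (n := n) L b).Y.biUnion (stars T)

/-- **The `ℋ`-side encoding is good** (probes are fresh genuine edges, `1` per edge query and `T` per
bonus). [cite: MartineauSevero2019, §5] -/
theorem goodEnc_I (hn : n ≠ 1) (L T : ℕ) : GoodEnc (n := n) L T (encI T) (GI n T) := by
  refine goodEnc_of_used L T (encI T) (GI n T) (usedI L T) ?_ ?_ ?_ ?_
  · intro b q hq
    cases q with
    | edge a d =>
      obtain ⟨-, he, -⟩ := nq_edge_spec hq
      intro f hf
      simp only [encI, Finset.coe_singleton, Set.mem_singleton_iff] at hf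
      subst hf
      exact ιE_mem_edgeSet (mem_edgeSet_of_mem_KE hn he)
    | col y =>
      intro f hf
      obtain ⟨j, hj, rfl⟩ := mem_stars_iff.1 hf
      exact ray_mem_edgeSet y hj
  · intro b q hq
    cases q with
    | edge a d => simp [encI, qsize]
    | col y => simp [encI, qsize, card_stars]
  · intro b q a hq
    rw [usedI, usedI, stateOf_cons_of_some hq]
    cases q with
    | edge a' d =>
      simp only [encI, hstep]
      intro f hf
      simp only [Finset.mem_union, Finset.mem_singleton, Finset.mem_image, Finset.mem_insert, Finset.mem_biUnion] at hf ⊢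
      rcases hf with rfl | ⟨e, he, rfl⟩ | h
      · exact Or.inl ⟨_, Or.inl rfl, rfl⟩
      · exact Or.inl ⟨e, Or.inr he, rfl⟩
      · exact Or.inr h
    | col y =>
      simp only [encI, hstep]
      intro f hf
      simp only [Finset.mem_union, Finset.mem_image, Finset.mem_biUnion, Finset.mem_insert] at hf ⊢
      rcases hf with h | h | ⟨y', hy', h⟩
      · exact Or.inr ⟨y, Or.inl rfl, h⟩
      · exact Or.inl h
      · exact Or.inr ⟨y', Or.inr hy', h⟩
  · intro b q hq
    cases q with
    | edge a d =>
      obtain ⟨-, -, hQ⟩ := nq_edge_spec hq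
      simp only [encI, usedI, Finset.disjoint_singleton_left, Finset.mem_union, Finset.mem_image,
        Finset.mem_biUnion, not_or, not_exists, not_and]
      refine ⟨fun e he h => hQ ?_, fun y _ hf => ?_⟩
      · rwa [← ιE_injective h]
      · obtain ⟨j, -, hj⟩ := mem_stars_iff.1 hf
        exact ιE_ne_ray _ y j hj
    | col y =>
      obtain ⟨-, -, hY, -⟩ := nq_col_spec hq
      simp only [encI, usedI, Finset.disjoint_left, Finset.mem_union, Finset.mem_image, Finset.mem_biUnion,
        not_or, not_exists, not_and]
      intro f hf
      obtain ⟨j, -, rfl⟩ := mem_stars_iff.1 hf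
      refine ⟨fun e _ h => ιE_ne_ray e y j h, fun y' hy' hf' => ?_⟩
      obtain ⟨j', -, hj'⟩ := mem_stars_iff.1 hf'
      exact ray_ne_ray (fun h => by subst h; exact hY hy') j j' hj'

end EncI


/-! ### Decoding a configuration of the auxiliary graph -/

/-- The `ℋ`-configuration encoded by `ω`: `e` is open iff its copy is. [cite: MartineauSevero2019, §5] -/
def decE (ω : BondConfig (VI n)) : Set (Sym2 (Vert n)) := {e | ιE e ∈ ω}

/-- The marks encoded by `ω`: `y` is marked iff all `T` rays of its star are open (probability `p^T`).
[cite: MartineauSevero2019, §4 (α with law Ber(s))] -/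
def decM (T : ℕ) (ω : BondConfig (VI n)) : Set (Site 2) := {y | ∀ j < T, ray (n := n) y j ∈ ω}

/-- The combined configuration on `Coord n` encoded by `ω`. [folklore] -/
def decode (T : ℕ) (ω : BondConfig (VI n)) : Set (Coord n) :=
  {c | Sum.elim (fun e => ιE e ∈ ω) (fun y => ∀ j < T, ray (n := n) y j ∈ ω) c}

/-- Edge part of the decoded configuration. [folklore] -/
@[simp] theorem preimage_inl_decode (T : ℕ) (ω : BondConfig (VI n)) : Sum.inl ⁻¹' decode T ω = decE ω := rfl

/-- Mark part of the decoded configuration. [folklore] -/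
@[simp] theorem preimage_inr_decode (T : ℕ) (ω : BondConfig (VI n)) : Sum.inr ⁻¹' decode T ω = decM T ω := rfl

/-- A probe finds all its coins open iff they all lie in `ω`. [folklore] -/
theorem obs_eq_self_iff {W : Type*} {ω : BondConfig W} {D : Finset (Sym2 W)} : obs ω D = D ↔ ∀ f ∈ D, f ∈ ω := by
  constructor
  · intro h f hf
    have : f ∈ obs ω D := h.symm ▸ hf
    exact (mem_obs_iff.1 this).2
  · intro h
    ext f
    simp only [mem_obs_iff, and_iff_left_iff_imp]
    exact fun hf => h f hf

section Correctness

variable [NeZero n] (L T : ℕ) (ω : BondConfig (VI n))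

/-- **Consistency of a transcript with the configuration**: every recorded answer is the truth about
`ω` (edge open / column marked). [cite: MartineauSevero2019, §5] -/
def AnsOK : List Bool → Prop
  | [] => True
  | a :: b => AnsOK b ∧ match nq L (stateOf (n := n) L b) with
    | none => True
    | some (Query.edge a' d) => (a = true ↔ s(a', nbr a' d) ∈ decE ω)
    | some (Query.col y) => (a = true ↔ y ∈ decM (n := n) T ω)

/-- **Along a run of the `ℋ`-side exploration, the transcript is consistent with `ω`.**
[cite: MartineauSevero2019, §5] -/
theorem ansOK_bt_hist (hn : n ≠ 1) (k : ℕ) : AnsOK (n := n) L T ω (bt ((texpl L (encI (n := n) T)).hist k ω)) := by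
  induction k with
  | zero => simp [AnsOK]
  | succ k ih =>
    have hrec := bt_hist_succ_eq (goodEnc_I hn L T) k ω
    cases hw : wanted L (encI (n := n) T) (bt ((texpl L (encI (n := n) T)).hist k ω)) with
    | none => rw [hw] at hrec; simp only at hrec; rw [hrec]; exact ih
    | some D =>
      rw [hw] at hrec
      simp only at hrec
      rw [hrec]
      refine ⟨ih, ?_⟩
      unfold wanted at hw
      cases hq : nq L (stateOf (n := n) L (bt ((texpl L (encI (n := n) T)).hist k ω))) with
      | none => rw [hq] at hw; cases hw
      | some q =>
        rw [hq] at hw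
        simp only [Option.map_some, Option.some.injEq] at hw
        subst hw
        cases q with
        | edge a d =>
          simp only [decide_eq_true_eq, obs_eq_self_iff, encI, Finset.mem_singleton, forall_eq]
          rfl
        | col y =>
          simp only [decide_eq_true_eq, obs_eq_self_iff, encI, mem_stars_iff, decM, Set.mem_setOf_eq]
          constructor
          · intro h j hj
            exact h _ ⟨j, hj, rfl⟩
          · rintro h f ⟨j, hj, rfl⟩
            exact h j hj

/-- The explored set only grows. [folklore] -/
theorem A_subset_A_cons (a : Bool) (b : List Bool) : (stateOf (n := n) L b).A ⊆ (stateOf (n := n) L (a :: b)).A := by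
  rw [stateOf_cons]
  cases nq L (stateOf (n := n) L b) with
  | none => exact le_rfl
  | some q =>
    cases q with
    | edge a' d =>
      simp only [hstep]
      split_ifs
      · exact Finset.subset_insert _ _
      · exact le_rfl
    | col y =>
      simp only [hstep]
      split_ifs
      · exact Finset.subset_union_left
      · exact le_rfl

/-- **Structural invariants of the replayed state** (every transcript): the origin is explored; open
queried edges are queried; an open queried edge was queried as `s(a, nbr a d)` with both endpoints
explored. [cite: MartineauSevero2019, §5 (Conditions at the end of each iteration)] -/
theorem inv_struct (b : List Bool) :
    origin n ∈ (stateOf (n := n) L b).A ∧ (stateOf (n := n) L b).O ⊆ (stateOf (n := n) L b).Q ∧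
      (∀ e ∈ (stateOf (n := n) L b).O, ∃ (a : Vert n) (d : Dir), e = s(a, nbr a d) ∧
        a ∈ (stateOf (n := n) L b).A ∧ nbr a d ∈ (stateOf (n := n) L b).A) := by
  induction b with
  | nil =>
    simp [stateOf, HState.init]
  | cons a b ih =>
    obtain ⟨h1, h2, h3⟩ := ih
    have hA := A_subset_A_cons (n := n) L a b
    rw [stateOf_cons] at hA ⊢
    cases hq : nq L (stateOf (n := n) L b) with
    | none => rw [hq] at hA; exact ⟨h1, h2, h3⟩
    | some q =>
      rw [hq] at hA
      cases q with
      | edge a' d =>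
        obtain ⟨ha', -, -⟩ := nq_edge_spec hq
        simp only [hstep] at hA ⊢
        refine ⟨hA h1, ?_, ?_⟩
        · split_ifs
          · exact Finset.insert_subset_insert _ h2
          · exact h2.trans (Finset.subset_insert _ _)
        · intro e he
          split_ifs at he with hb
          · rcases Finset.mem_insert.1 he with rfl | he
            · exact ⟨a', d, rfl, hA ha', by simp [hb]⟩
            · obtain ⟨a₁, d₁, rfl, h₁, h₂⟩ := h3 _ he
              exact ⟨a₁, d₁, rfl, hA h₁, hA h₂⟩
          · obtain ⟨a₁, d₁, rfl, h₁, h₂⟩ := h3 _ he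
            exact ⟨a₁, d₁, rfl, hA h₁, hA h₂⟩
      | col y =>
        simp only [hstep] at hA ⊢
        refine ⟨hA h1, h2, fun e he => ?_⟩
        obtain ⟨a₁, d₁, rfl, h₁, h₂⟩ := h3 _ he
        exact ⟨a₁, d₁, rfl, hA h₁, hA h₂⟩

variable {L T ω}

/-- **Semantic invariants of a consistent transcript**: a queried edge is recorded open iff it is
open in `decE ω`; a marked attempted column has its four neighbouring columns explored; every
explored vertex lies in the enhanced cluster of the decoded configuration.
[cite: MartineauSevero2019, §5 ("C'_∞ is included in the cluster …", "π surjects C'_∞ onto C_∞")] -/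
theorem inv_sem (hn : n ≠ 1) {b : List Bool} (hb : AnsOK (n := n) L T ω b) :
    (∀ e ∈ (stateOf (n := n) L b).Q, (e ∈ (stateOf (n := n) L b).O ↔ e ∈ decE ω)) ∧
      (∀ y ∈ (stateOf (n := n) L b).Y, y ∈ decM (n := n) T ω → nbhdVerts y ⊆ (stateOf (n := n) L b).A) ∧
      (∀ v ∈ (stateOf (n := n) L b).A, InCl L (decE ω) (decM (n := n) T ω) v) := by
  induction b with
  | nil =>
    simp only [stateOf, HState.init, Finset.notMem_empty, false_iff, IsEmpty.forall_iff, implies_true,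
      Finset.mem_singleton, forall_eq, true_and]
    exact InCl.origin
  | cons a b ih =>
    obtain ⟨hb, hans⟩ := hb
    obtain ⟨h1, h2, h3⟩ := ih hb
    obtain ⟨_, hOQ, hO⟩ := inv_struct (n := n) L b
    rw [stateOf_cons]
    cases hq : nq L (stateOf (n := n) L b) with
    | none => exact ⟨h1, h2, h3⟩
    | some q =>
      rw [hq] at hans
      cases q with
      | edge a' d =>
        obtain ⟨ha', he', hQ⟩ := nq_edge_spec hq
        simp only at hans
        simp only [hstep]
        refine ⟨?_, ?_, ?_⟩
        · intro e he
          rcases Finset.mem_insert.1 he with rfl | he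
          · split_ifs with hb'
            · simp only [Finset.mem_insert, true_or, true_iff]
              exact hans.1 hb'
            · constructor
              · intro h; exact absurd (hOQ h) hQ
              · intro h; exact absurd (hans.2 h) hb'
          · split_ifs with hb'
            · rw [Finset.mem_insert, h1 e he, or_iff_right_iff_imp]
              rintro rfl
              exact hans.1 hb'
            · exact h1 e he
        · intro y hy hyM
          split_ifs
          · exact (h2 y hy hyM).trans (Finset.subset_insert _ _)
          · exact h2 y hy hyM
        · intro v hv
          split_ifs at hv with hb'
          · rcases Finset.mem_insert.1 hv with rfl | hv
            · have hopen : s(a', nbr a' d) ∈ decE ω := hans.1 hb'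
              exact InCl.edge (h3 _ ha') (adj_nbr hn a' d) hopen ((mk_mem_EL_iff.1 ((mem_KE_iff_mem_EL hn).1 he')).2)
            · exact h3 v hv
          · exact h3 v hv
      | col y =>
        obtain ⟨-, hybox, -, hopen⟩ := nq_col_spec hq
        simp only at hans
        simp only [hstep]
        refine ⟨h1, ?_, ?_⟩
        · intro y' hy' hy'M
          rcases Finset.mem_insert.1 hy' with rfl | hy'
          · have : a = true := hans.2 hy'M
            simp only [this, if_true]
            exact Finset.subset_union_right
          · split_ifs
            · exact (h2 y' hy' hy'M).trans Finset.subset_union_left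
            · exact h2 y' hy' hy'M
        · intro v hv
          split_ifs at hv with hb'
          · rcases Finset.mem_union.1 hv with hv | hv
            · exact h3 v hv
            · -- the bonus of `y` fires in the decoded configuration
              have hyM : y ∈ decM (n := n) T ω := hans.1 hb'
              have hcyc : ∀ t : ZMod n, s(((t, y) : Vert n), (t + 1, y)) ∈ decE ω := fun t =>
                (h1 _ (hOQ (hopen t))).1 (hopen t)
              have h0 : ((0 : ZMod n), y) ∈ (stateOf (n := n) L b).A := by
                obtain ⟨a₁, d₁, he, ha₁, hb₁⟩ := hO _ (hopen 0)
                rcases (Sym2.eq_iff.1 he) with ⟨h, -⟩ | ⟨h, -⟩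
                · rw [h]; exact ha₁
                · rw [h]; exact hb₁
              have := InCl.bonus' (a := ((0 : ZMod n), y)) (h3 _ h0) hyM (mem_box_iff_pnorm_le.1 hybox) hcyc v.1
                (mem_nbhdVerts_iff.1 hv)
              exact this
          · exact h3 v hv

/-- **Completeness at halting**: for a consistent transcript after which the machine has halted, every
vertex of the enhanced cluster of the decoded configuration has been explored.
[cite: MartineauSevero2019, §5 (Step ∞)] -/
theorem mem_A_of_inCl (hn : n ≠ 1) {b : List Bool} (hb : AnsOK (n := n) L T ω b)
    (hnone : nq L (stateOf (n := n) L b) = none) {v : Vert n} (hv : InCl L (decE ω) (decM (n := n) T ω) v) :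
    v ∈ (stateOf (n := n) L b).A := by
  obtain ⟨hQall, hYall⟩ := nq_eq_none_iff.1 hnone
  obtain ⟨horig, hOQ, hO⟩ := inv_struct (n := n) L b
  obtain ⟨h1, h2, -⟩ := inv_sem hn hb
  -- an open edge of `E_L` at an explored vertex leads to an explored vertex
  have hedge : ∀ (a : Vert n) (d : Dir), a ∈ (stateOf (n := n) L b).A → s(a, nbr a d) ∈ KE n L →
      s(a, nbr a d) ∈ decE ω → nbr a d ∈ (stateOf (n := n) L b).A := by
    intro a d ha he hopen
    have hQ := hQall a ha d he
    have hOe := (h1 _ hQ).2 hopen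
    obtain ⟨a₁, d₁, heq, ha₁, hb₁⟩ := hO _ hOe
    rcases (Sym2.eq_iff.1 heq) with ⟨-, h⟩ | ⟨-, h⟩
    · rw [h]; exact hb₁
    · rw [h]; exact ha₁
  induction hv with
  | origin => exact horig
  | @edge a' b' _ hab he hL ih =>
    obtain ⟨d, rfl⟩ := exists_dir_of_adj hab
    exact hedge a' d ih ((mem_KE_iff_mem_EL hn).2 (mk_mem_EL_iff.2 ⟨hab, hL⟩)) he
  | @bonus a' b' _ hα hL hcyc hadj ih =>
    -- the whole column of `a'` is explored, through its open vertical edges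
    have hcol : ∀ k : ℕ, (a'.1 + k, a'.2) ∈ (stateOf (n := n) L b).A := by
      intro k
      induction k with
      | zero => simpa using ih
      | succ k ihk =>
        have hstep := hedge (a'.1 + k, a'.2) ((0 : Fin 3), true) ihk
          ((mem_KE_iff_mem_EL hn).2 (by rw [(nbr_zero _).1]; exact cycE_subset_EL hn hL ⟨a'.1 + k, rfl⟩))
          (by rw [(nbr_zero _).1]; exact hcyc _)
        rw [(nbr_zero _).1] at hstep
        simpa [Nat.cast_succ, add_assoc] using hstep
    have hcolT : ∀ t : ZMod n, (t, a'.2) ∈ (stateOf (n := n) L b).A := fun t => by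
      obtain ⟨k, rfl⟩ := exists_eq_add_natCast a'.1 t
      exact hcol k
    -- hence it is explored-open, its bonus was attempted, and the neighbouring columns are explored
    have hopen : colOpen (stateOf (n := n) L b) a'.2 := by
      intro t
      have he : s(((t, a'.2) : Vert n), nbr (t, a'.2) ((0 : Fin 3), true)) ∈ KE n L :=
        (mem_KE_iff_mem_EL hn).2 (by rw [(nbr_zero _).1]; exact cycE_subset_EL hn hL ⟨t, rfl⟩)
      have hQ := hQall _ (hcolT t) _ he
      rw [(nbr_zero _).1] at hQ he
      exact (h1 _ hQ).2 (hcyc t)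
    have hY := hYall a'.2 (mem_box_iff_pnorm_le.2 hL) hopen
    exact h2 _ hY hα (mem_nbhdVerts_iff.2 hadj)

/-- The transcript event "a column of sup-norm `L + 1` has been explored". [cite: MartineauSevero2019, §6 (𝓔_L)] -/
def ReachState (L : ℕ) (σ : HState n) : Prop := ∃ v ∈ σ.A, pnorm v.2 = L + 1

/-- **Exploration correctness**: for a consistent halted transcript, "a column of sup-norm `L+1` was
explored" iff `𝓔_L` holds for the decoded configuration. [cite: MartineauSevero2019, §5 (Step ∞)] -/
theorem reachState_iff_reaches (hn : n ≠ 1) {b : List Bool} (hb : AnsOK (n := n) L T ω b)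
    (hnone : nq L (stateOf (n := n) L b) = none) :
    ReachState L (stateOf (n := n) L b) ↔ Reaches L (decE ω) (decM (n := n) T ω) := by
  constructor
  · rintro ⟨v, hv, hvL⟩
    exact ⟨v, (inv_sem hn hb).2.2 v hv, hvL⟩
  · rintro ⟨v, hv, hvL⟩
    exact ⟨v, mem_A_of_inCl hn hb hnone hv, hvL⟩

/-- **The `ℋ`-side run computes `𝓔_L`**: for `k > |E_L| + |box L|`, the transcript event `ReachState`
at time `k` is the event `decode ω ∈ 𝓔_L`. [cite: MartineauSevero2019, §5 (Step ∞)] -/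
theorem setOf_reachState_eq (hn : n ≠ 1) (L T k : ℕ) (hk : (KE n L).card + (box 2 L).card < k) :
    {ω : BondConfig (VI n) | ReachState L (stateOf (n := n) L (bt ((texpl L (encI (n := n) T)).hist k ω)))} =
      {ω | decode (n := n) T ω ∈ ev L} := by
  ext ω
  simp only [Set.mem_setOf_eq, ev, preimage_inl_decode, preimage_inr_decode]
  exact reachState_iff_reaches hn (ansOK_bt_hist L T ω hn k) (nq_stateOf_bt_eq_none (goodEnc_I hn L T) k hk ω)

end Correctness


end SlabTorus

/-! ### Product-weight identities used to factorise the star blocks -/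

namespace ProdWeight

variable {ι : Type*} [DecidableEq ι]

/-- On a disjoint union, the weight of `S₁ ∪ S₂` (`S₁ ⊆ U`, `S₂ ⊆ V`) factorises. [folklore] -/
theorem prod_gwt_union {U V S₁ S₂ : Finset ι} (hUV : Disjoint U V) (h₁ : S₁ ⊆ U) (h₂ : S₂ ⊆ V) (q : ι → ℝ) :
    ∏ i ∈ U ∪ V, gwt q (S₁ ∪ S₂) i = (∏ i ∈ U, gwt q S₁ i) * ∏ i ∈ V, gwt q S₂ i := by
  rw [Finset.prod_union hUV]
  congr 1
  · refine Finset.prod_congr rfl fun i hi => ?_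
    have : i ∈ S₁ ∪ S₂ ↔ i ∈ S₁ := by
      simp only [Finset.mem_union, or_iff_left_iff_imp]
      exact fun h => absurd hi (Finset.disjoint_left.1 hUV.symm (h₂ h))
    simp [gwt, this]
  · refine Finset.prod_congr rfl fun i hi => ?_
    have : i ∈ S₁ ∪ S₂ ↔ i ∈ S₂ := by
      simp only [Finset.mem_union, or_iff_right_iff_imp]
      exact fun h => absurd hi (Finset.disjoint_left.1 hUV (h₁ h))
    simp [gwt, this]

/-- **The weights of all subsets sum to one**: `Σ_{t ⊆ U} ∏_{i ∈ U} w_i(t) = ∏_{i ∈ U} (q i + (1 - q i)) = 1`.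
[folklore] -/
theorem sum_powerset_prod_gwt (U : Finset ι) (q : ι → ℝ) : ∑ t ∈ U.powerset, ∏ i ∈ U, gwt q t i = 1 := by
  have h := Finset.prod_add q (fun i => 1 - q i) U
  simp only [add_sub_cancel, Finset.prod_const_one] at h
  rw [h]
  refine Finset.sum_congr rfl fun t ht => ?_
  have htU : t ⊆ U := Finset.mem_powerset.1 ht
  rw [← Finset.union_sdiff_of_subset htU, Finset.prod_union Finset.disjoint_sdiff,
    Finset.union_sdiff_of_subset htU]
  congr 1
  · exact Finset.prod_congr rfl fun i hi => by simp [gwt, hi]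
  · exact Finset.prod_congr rfl fun i hi => by simp [gwt, (Finset.mem_sdiff.1 hi).2]

/-- Summing over the subsets of a disjoint union is summing over pairs of subsets. [folklore] -/
theorem sum_powerset_union {U V : Finset ι} (hUV : Disjoint U V) (f : Finset ι → ℝ) :
    ∑ S ∈ (U ∪ V).powerset, f S = ∑ S₁ ∈ U.powerset, ∑ S₂ ∈ V.powerset, f (S₁ ∪ S₂) := by
  rw [← Finset.sum_product']
  symm
  refine Finset.sum_nbij' (fun P => P.1 ∪ P.2) (fun S => (S ∩ U, S ∩ V)) ?_ ?_ ?_ ?_ ?_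
  · rintro ⟨S₁, S₂⟩ hP
    simp only [Finset.mem_product, Finset.mem_powerset] at hP ⊢
    exact Finset.union_subset_union hP.1 hP.2
  · intro S hS
    simp only [Finset.mem_product, Finset.mem_powerset]
    exact ⟨Finset.inter_subset_right, Finset.inter_subset_right⟩
  · rintro ⟨S₁, S₂⟩ hP
    simp only [Finset.mem_product, Finset.mem_powerset] at hP
    ext i
    · simp only [Finset.mem_inter, Finset.mem_union]
      constructor
      · rintro ⟨h | h, hi⟩
        · exact h
        · exact absurd hi (Finset.disjoint_left.1 hUV.symm (hP.2 h))
      · exact fun h => ⟨Or.inl h, hP.1 h⟩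
    · simp only [Finset.mem_inter, Finset.mem_union]
      constructor
      · rintro ⟨h | h, hi⟩
        · exact absurd hi (Finset.disjoint_left.1 hUV (hP.1 h))
        · exact h
      · exact fun h => ⟨Or.inr h, hP.2 h⟩
  · intro S hS
    simp only [Finset.mem_powerset] at hS
    simp only
    rw [← Finset.inter_union_distrib_left, Finset.inter_eq_left.2 hS]
  · intro P _; rfl

/-- **One block of constant parameter `p`**: the subsets of `U` contribute `p^{|U|}` if the block is
required full and `1 - p^{|U|}` otherwise (`Σ_{S ⊆ U, (S = U ↔ P)} ∏ w = p^|U|` or `1 - p^|U|`).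
[folklore] -/
theorem sum_block (U : Finset ι) (p : ℝ) (P : Prop) [Decidable P] :
    ∑ S ∈ U.powerset.filter (fun S => (S = U ↔ P)), ∏ i ∈ U, gwt (fun _ => p) S i =
      if P then p ^ U.card else 1 - p ^ U.card := by
  have hfull : ∏ i ∈ U, gwt (fun _ => p) U i = p ^ U.card := by
    calc ∏ i ∈ U, gwt (fun _ => p) U i = ∏ _i ∈ U, p := Finset.prod_congr rfl fun i hi => by simp [gwt, hi]
      _ = p ^ U.card := Finset.prod_const p
  by_cases hP : P
  · simp only [hP, iff_true, if_true]
    have : U.powerset.filter (fun S => S = U) = {U} := by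
      ext S; simp [Finset.mem_filter, Finset.mem_powerset]; rintro rfl; exact le_rfl
    rw [this, Finset.sum_singleton, hfull]
  · simp only [hP, iff_false, if_false]
    have htot := sum_powerset_prod_gwt U (fun _ => p)
    rw [← Finset.sum_filter_add_sum_filter_not U.powerset (fun S => S = U)] at htot
    have h1 : ∑ S ∈ U.powerset.filter (fun S => S = U), ∏ i ∈ U, gwt (fun _ => p) S i = p ^ U.card := by
      have : U.powerset.filter (fun S => S = U) = {U} := by
        ext S; simp [Finset.mem_filter, Finset.mem_powerset]; rintro rfl; exact le_rfl
      rw [this, Finset.sum_singleton, hfull]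
    linarith

end ProdWeight

namespace SlabTorus

variable {n : ℕ}

/-! ### The identification `P_{GI, p}(𝓔_L ∘ decode) = Θ_L(p, p^T)` -/

section Identification

variable [NeZero n] (L T : ℕ)

/-- The finite set of coins of `GI` that determine `𝓔_L ∘ decode`: copies of `E_L` and the stars of
`box L`. [folklore] -/
noncomputable def KI (n : ℕ) [NeZero n] (L T : ℕ) : Finset (Sym2 (VI n)) :=
  (KE n L).image ιE ∪ (box 2 L).biUnion (stars T)

/-- Copies of `E_L` and stars are disjoint. [folklore] -/
theorem disjoint_image_biUnion_stars (C : Finset (Site 2)) :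
    Disjoint ((KE n L).image ιE) (C.biUnion (stars (n := n) T)) := by
  rw [Finset.disjoint_left]
  intro f hf hf'
  obtain ⟨e, -, rfl⟩ := Finset.mem_image.1 hf
  obtain ⟨y, -, hy⟩ := Finset.mem_biUnion.1 hf'
  obtain ⟨j, -, hj⟩ := mem_stars_iff.1 hy
  exact ιE_ne_ray e y j hj

/-- `𝓔_L ∘ decode` is determined by `KI`. [cite: MartineauSevero2019, §6 ("depends only on finitely many coordinates")] -/
theorem determinedBy_decode_ev (hn : n ≠ 1) :
    DeterminedBy {ω : Set (Sym2 (VI n)) | decode (n := n) T ω ∈ ev L} (↑(KI n L T) : Set (Sym2 (VI n))) := by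
  rw [determinedBy_iff]
  have key : ∀ ω ω' : Set (Sym2 (VI n)), ω ∩ ↑(KI n L T) = ω' ∩ ↑(KI n L T) →
      decode (n := n) T ω ∈ ev L → decode (n := n) T ω' ∈ ev L := by
    intro ω ω' hωω' h
    simp only [ev, Set.mem_setOf_eq, preimage_inl_decode, preimage_inr_decode] at h ⊢
    have hmem : ∀ f ∈ KI n L T, f ∈ ω → f ∈ ω' := fun f hf hfω =>
      ((Set.ext_iff.1 hωω' f).1 ⟨hfω, hf⟩).1
    refine h.congr hn (fun e he heω => ?_) (fun y hy hyω j hj => ?_)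
    · exact hmem _ (Finset.mem_union_left _ (Finset.mem_image_of_mem _ ((mem_KE_iff_mem_EL hn).2 he))) heω
    · refine hmem _ (Finset.mem_union_right _ (Finset.mem_biUnion.2 ⟨y, mem_box_iff_pnorm_le.2 hy, ?_⟩)) (hyω j hj)
      exact mem_stars_iff.2 ⟨j, hj, rfl⟩
  intro ω ω' h
  exact ⟨key ω ω' h, key ω' ω h.symm⟩

/-- The projection of a coin configuration of `GI` to a combined configuration on `K`. [folklore] -/
noncomputable def proj (S : Finset (Sym2 (VI n))) : Finset (Coord n) :=
  ((KE n L).filter fun e => ιE e ∈ S).disjSum ((box 2 L).filter fun y => stars T y ⊆ S)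

/-- `proj S ⊆ K`. [folklore] -/
theorem proj_subset (S : Finset (Sym2 (VI n))) : proj (n := n) L T S ⊆ K n L :=
  Finset.disjSum_mono (Finset.filter_subset _ _) (Finset.filter_subset _ _)

/-- Membership of an edge coordinate in the projection. [folklore] -/
theorem inl_mem_proj {S : Finset (Sym2 (VI n))} {e : Sym2 (Vert n)} :
    (Sum.inl e : Coord n) ∈ proj (n := n) L T S ↔ e ∈ KE n L ∧ ιE e ∈ S := by
  rw [proj, Finset.inl_mem_disjSum, Finset.mem_filter]

/-- Membership of a mark coordinate in the projection. [folklore] -/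
theorem inr_mem_proj {S : Finset (Sym2 (VI n))} {y : Site 2} :
    (Sum.inr y : Coord n) ∈ proj (n := n) L T S ↔ y ∈ box 2 L ∧ stars T y ⊆ S := by
  rw [proj, Finset.inr_mem_disjSum, Finset.mem_filter]

/-- **The decoded event only sees the projection**: `decode ↑S ∈ 𝓔_L ↔ ↑(proj S) ∈ 𝓔_L`. [folklore] -/
theorem decode_mem_ev_iff (hn : n ≠ 1) (S : Finset (Sym2 (VI n))) :
    decode (n := n) T (↑S : Set (Sym2 (VI n))) ∈ ev L ↔ (↑(proj (n := n) L T S) : Set (Coord n)) ∈ ev L := by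
  simp only [ev, Set.mem_setOf_eq, preimage_inl_decode, preimage_inr_decode]
  constructor
  · intro h
    refine h.congr hn (fun e he heS => ?_) (fun y hy hyS => ?_)
    · change (Sum.inl e : Coord n) ∈ (↑(proj (n := n) L T S) : Set (Coord n))
      rw [Finset.mem_coe, inl_mem_proj]
      exact ⟨(mem_KE_iff_mem_EL hn).2 he, heS⟩
    · change (Sum.inr y : Coord n) ∈ (↑(proj (n := n) L T S) : Set (Coord n))
      rw [Finset.mem_coe, inr_mem_proj]
      refine ⟨mem_box_iff_pnorm_le.2 hy, fun f hf => ?_⟩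
      obtain ⟨j, hj, rfl⟩ := mem_stars_iff.1 hf
      exact hyS j hj
  · intro h
    refine h.congr hn (fun e _ heS => ?_) (fun y _ hyS => ?_)
    · have : (Sum.inl e : Coord n) ∈ proj (n := n) L T S := by simpa using heS
      exact ((inl_mem_proj L T).1 this).2
    · have : (Sum.inr y : Coord n) ∈ proj (n := n) L T S := by simpa using hyS
      intro j hj
      exact ((inr_mem_proj L T).1 this).2 (mem_stars_iff.2 ⟨j, hj, rfl⟩)

/-- **Factorisation of a fibre of the projection** (induction on the set of columns `C`): summing the
weights of the configurations `S ⊆ ιE(E_L) ∪ stars(C)` with prescribed edge part and prescribed set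
of full stars gives the product of the edge weights and, per column, `p^T` or `1 - p^T`.
[cite: MartineauSevero2019, §4 (α ~ Ber(s)^{⊗V}, s = p^T)] -/
theorem fibre_sum (p : ℝ) (R : Finset (Coord n)) (C : Finset (Site 2)) :
    ∑ S ∈ ((KE n L).image ιE ∪ C.biUnion (stars T)).powerset.filter
        (fun S => (∀ e ∈ KE n L, (ιE e ∈ S ↔ (Sum.inl e : Coord n) ∈ R)) ∧
          ∀ y ∈ C, (stars T y ⊆ S ↔ (Sum.inr y : Coord n) ∈ R)),
        ∏ i ∈ (KE n L).image ιE ∪ C.biUnion (stars T), ProdWeight.gwt (fun _ => p) S i =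
      (∏ e ∈ KE n L, ProdWeight.gwt (par p (p ^ T)) R (Sum.inl e)) *
        ∏ y ∈ C, ProdWeight.gwt (par p (p ^ T)) R (Sum.inr y) := by
  induction C using Finset.induction_on with
  | empty =>
    rw [Finset.biUnion_empty, Finset.union_empty, Finset.prod_empty, mul_one]
    -- the only admissible `S` is the image of the edge part of `R`
    set S₀ : Finset (Sym2 (VI n)) := ((KE n L).filter fun e => (Sum.inl e : Coord n) ∈ R).image ιE with hS₀
    have hmemS₀ : ∀ e ∈ KE n L, (ιE e ∈ S₀ ↔ (Sum.inl e : Coord n) ∈ R) := fun e he => by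
      rw [hS₀, ιE_injective.mem_finset_image, Finset.mem_filter]
      simp [he]
    have hfilter : ((KE n L).image ιE).powerset.filter
        (fun S => (∀ e ∈ KE n L, (ιE e ∈ S ↔ (Sum.inl e : Coord n) ∈ R)) ∧
          ∀ y ∈ (∅ : Finset (Site 2)), (stars T y ⊆ S ↔ (Sum.inr y : Coord n) ∈ R)) = {S₀} := by
      ext S
      simp only [Finset.mem_filter, Finset.mem_powerset, Finset.mem_singleton, Finset.notMem_empty,
        IsEmpty.forall_iff, implies_true, and_true]
      constructor
      · rintro ⟨hS, hiff⟩
        ext f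
        constructor
        · intro hf
          obtain ⟨e, he, rfl⟩ := Finset.mem_image.1 (hS hf)
          exact Finset.mem_image.2 ⟨e, Finset.mem_filter.2 ⟨he, (hiff e he).1 hf⟩, rfl⟩
        · intro hf
          obtain ⟨e, he, rfl⟩ := Finset.mem_image.1 hf
          obtain ⟨he, heR⟩ := Finset.mem_filter.1 he
          exact (hiff e he).2 heR
      · rintro rfl
        exact ⟨Finset.image_subset_image (Finset.filter_subset _ _), hmemS₀⟩
    rw [hfilter, Finset.sum_singleton, Finset.prod_image fun e _ e' _ h => ιE_injective h]
    refine Finset.prod_congr rfl fun e he => ?_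
    simp only [ProdWeight.gwt, hmemS₀ e he, par, Sum.elim_inl]
  | @insert y₀ C hy₀ ih =>
    set U : Finset (Sym2 (VI n)) := (KE n L).image ιE ∪ C.biUnion (stars T) with hU
    have hdisjU : Disjoint U (stars T y₀) := by
      rw [hU, Finset.disjoint_union_left]
      refine ⟨disjoint_image_biUnion_stars L T {y₀} |>.mono_right (by simp), ?_⟩
      rw [Finset.disjoint_biUnion_left]
      intro y hy
      exact disjoint_stars T (fun h => hy₀ (h ▸ hy))
    have hunion : (KE n L).image ιE ∪ (insert y₀ C).biUnion (stars T) = U ∪ stars T y₀ := by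
      rw [Finset.biUnion_insert, hU]
      ext f; simp only [Finset.mem_union]; tauto
    rw [hunion, Finset.sum_filter, ProdWeight.sum_powerset_union hdisjU, Finset.prod_insert hy₀]
    -- split constraints and weights
    have hsplit : ∀ S₁ ∈ U.powerset, ∀ S₂ ∈ (stars (n := n) T y₀).powerset,
        (if ((∀ e ∈ KE n L, (ιE e ∈ S₁ ∪ S₂ ↔ (Sum.inl e : Coord n) ∈ R)) ∧
            ∀ y ∈ insert y₀ C, (stars T y ⊆ S₁ ∪ S₂ ↔ (Sum.inr y : Coord n) ∈ R))
          then ∏ i ∈ U ∪ stars T y₀, ProdWeight.gwt (fun _ => p) (S₁ ∪ S₂) i else 0) =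
        (if ((∀ e ∈ KE n L, (ιE e ∈ S₁ ↔ (Sum.inl e : Coord n) ∈ R)) ∧
            ∀ y ∈ C, (stars T y ⊆ S₁ ↔ (Sum.inr y : Coord n) ∈ R))
          then ∏ i ∈ U, ProdWeight.gwt (fun _ => p) S₁ i else 0) *
        (if (S₂ = stars T y₀ ↔ (Sum.inr y₀ : Coord n) ∈ R)
          then ∏ i ∈ stars T y₀, ProdWeight.gwt (fun _ => p) S₂ i else 0) := by
      intro S₁ hS₁ S₂ hS₂
      rw [Finset.mem_powerset] at hS₁ hS₂
      have hE : ∀ e ∈ KE n L, (ιE e ∈ S₁ ∪ S₂ ↔ ιE e ∈ S₁) := by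
        intro e he
        simp only [Finset.mem_union, or_iff_left_iff_imp]
        intro h
        have h1 : ιE e ∈ U := Finset.mem_union_left _ (Finset.mem_image_of_mem _ he)
        exact absurd (hS₂ h) (Finset.disjoint_left.1 hdisjU h1)
      have hC : ∀ y ∈ C, (stars T y ⊆ S₁ ∪ S₂ ↔ stars T y ⊆ S₁) := by
        intro y hy
        constructor
        · intro h f hf
          rcases Finset.mem_union.1 (h hf) with h' | h'
          · exact h'
          · exfalso
            have h1 : f ∈ U := Finset.mem_union_right _ (Finset.mem_biUnion.2 ⟨y, hy, hf⟩)
            exact Finset.disjoint_left.1 hdisjU h1 (hS₂ h')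
        · exact fun h => h.trans Finset.subset_union_left
      have hy₀' : stars T y₀ ⊆ S₁ ∪ S₂ ↔ S₂ = stars T y₀ := by
        constructor
        · intro h
          refine le_antisymm hS₂ fun f hf => ?_
          rcases Finset.mem_union.1 (h hf) with h' | h'
          · exact absurd hf (Finset.disjoint_left.1 hdisjU (hS₁ h'))
          · exact h'
        · rintro rfl; exact Finset.subset_union_right
      rw [ProdWeight.prod_gwt_union hdisjU hS₁ hS₂]
      have hiff : ((∀ e ∈ KE n L, (ιE e ∈ S₁ ∪ S₂ ↔ (Sum.inl e : Coord n) ∈ R)) ∧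
            ∀ y ∈ insert y₀ C, (stars T y ⊆ S₁ ∪ S₂ ↔ (Sum.inr y : Coord n) ∈ R)) ↔
          (((∀ e ∈ KE n L, (ιE e ∈ S₁ ↔ (Sum.inl e : Coord n) ∈ R)) ∧
            ∀ y ∈ C, (stars T y ⊆ S₁ ↔ (Sum.inr y : Coord n) ∈ R)) ∧
            (S₂ = stars T y₀ ↔ (Sum.inr y₀ : Coord n) ∈ R)) := by
        rw [Finset.forall_mem_insert, hy₀']
        constructor
        · rintro ⟨h1, h2, h3⟩
          exact ⟨⟨fun e he => (hE e he).symm.trans (h1 e he), fun y hy => (hC y hy).symm.trans (h3 y hy)⟩, h2⟩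
        · rintro ⟨⟨h1, h3⟩, h2⟩
          exact ⟨fun e he => (hE e he).trans (h1 e he), h2, fun y hy => (hC y hy).trans (h3 y hy)⟩
      by_cases h1 : (∀ e ∈ KE n L, (ιE e ∈ S₁ ↔ (Sum.inl e : Coord n) ∈ R)) ∧
          ∀ y ∈ C, (stars T y ⊆ S₁ ↔ (Sum.inr y : Coord n) ∈ R)
      · by_cases h2 : (S₂ = stars T y₀ ↔ (Sum.inr y₀ : Coord n) ∈ R)
        · rw [if_pos (hiff.2 ⟨h1, h2⟩), if_pos h1, if_pos h2]
        · rw [if_neg (fun h => h2 (hiff.1 h).2), if_pos h1, if_neg h2, mul_zero]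
      · rw [if_neg (fun h => h1 (hiff.1 h).1), if_neg h1, zero_mul]
    rw [Finset.sum_congr rfl fun S₁ hS₁ => Finset.sum_congr rfl fun S₂ hS₂ => hsplit S₁ hS₁ S₂ hS₂]
    simp_rw [← Finset.mul_sum]
    rw [← Finset.sum_mul, ← Finset.sum_filter, ih, ← Finset.sum_filter, ProdWeight.sum_block, card_stars]
    simp only [ProdWeight.gwt, par, Sum.elim_inr]
    ring

/-- **`P_{GI,p}(𝓔_L ∘ decode) = Θ_L(p, p^T)`**: Bernoulli percolation on `ℋ_n ⊔ stars` at parameter `p`,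
decoded, is the `(p, p^T)` column model (edges open with probability `p`, columns marked with
probability `p^T`, all independent). [cite: MartineauSevero2019, §4 (ℙ_{p,s})] -/
theorem measureReal_decode_ev (hn : n ≠ 1) (p : unitInterval) :
    (bondPercolation (GI n T) p).real {ω | decode (n := n) T ω ∈ ev L} = Theta n L p ((p : ℝ) ^ T) := by
  classical
  have hB := determinedBy_decode_ev (n := n) L T hn
  rw [bondPercolation, Russo.measureReal_eq_cylPoly hB]
  -- the cylinder polynomial as a weighted count with `gwt`
  have hKI : ∀ i ∈ KI n L T, i ∈ (GI n T).edgeSet := by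
    intro i hi
    rcases Finset.mem_union.1 hi with hi | hi
    · obtain ⟨e, he, rfl⟩ := Finset.mem_image.1 hi
      exact ιE_mem_edgeSet (mem_edgeSet_of_mem_KE hn he)
    · obtain ⟨y, -, hy⟩ := Finset.mem_biUnion.1 hi
      obtain ⟨j, hj, rfl⟩ := mem_stars_iff.1 hy
      exact ray_mem_edgeSet y hj
  have hcyl : Russo.cylPoly (GI n T).edgeSet (KI n L T) {ω | decode (n := n) T ω ∈ ev L} p =
      ∑ S ∈ (KI n L T).powerset, if (↑(proj (n := n) L T S) : Set (Coord n)) ∈ ev L then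
        ∏ i ∈ KI n L T, ProdWeight.gwt (fun _ => (p : ℝ)) S i else 0 := by
    unfold Russo.cylPoly
    refine Finset.sum_congr rfl fun S _ => ?_
    rw [Set.mem_setOf_eq, decode_mem_ev_iff L T hn S]
    split_ifs
    · refine Finset.prod_congr rfl fun i hi => ?_
      simp [Russo.weight, ProdWeight.gwt, hKI i hi]
    · rfl
  rw [hcyl]
  -- regroup by the projection
  have hmaps : ∀ S ∈ (KI n L T).powerset, proj (n := n) L T S ∈ (K n L).powerset := fun S _ =>
    Finset.mem_powerset.2 (proj_subset L T S)
  rw [← Finset.sum_fiberwise_of_maps_to hmaps]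
  unfold Theta ProdWeight.gTheta ProdWeight.gW
  refine Finset.sum_congr rfl fun R hR => ?_
  rw [Finset.mem_powerset] at hR
  -- inside the fibre the indicator is constant
  have hfib : ∀ S ∈ (KI n L T).powerset.filter (fun S => proj (n := n) L T S = R),
      (if (↑(proj (n := n) L T S) : Set (Coord n)) ∈ ev L then ∏ i ∈ KI n L T, ProdWeight.gwt (fun _ => (p : ℝ)) S i else 0) =
      (if (↑R : Set (Coord n)) ∈ ev L then 1 else 0) * ∏ i ∈ KI n L T, ProdWeight.gwt (fun _ => (p : ℝ)) S i := by
    intro S hS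
    rw [(Finset.mem_filter.1 hS).2]
    split_ifs <;> simp
  rw [Finset.sum_congr rfl hfib, ← Finset.mul_sum]
  -- the fibre is described by the constraints of `fibre_sum`
  have hfilter : (KI n L T).powerset.filter (fun S => proj (n := n) L T S = R) =
      (KI n L T).powerset.filter (fun S => (∀ e ∈ KE n L, (ιE e ∈ S ↔ (Sum.inl e : Coord n) ∈ R)) ∧
        ∀ y ∈ box 2 L, (stars T y ⊆ S ↔ (Sum.inr y : Coord n) ∈ R)) := by
    refine Finset.filter_congr fun S _ => ?_
    constructor
    · rintro rfl
      exact ⟨fun e he => by rw [inl_mem_proj]; simp [he], fun y hy => by rw [inr_mem_proj]; simp [hy]⟩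
    · rintro ⟨hE, hM⟩
      ext c
      cases c with
      | inl e =>
        rw [inl_mem_proj]
        constructor
        · rintro ⟨he, heS⟩; exact (hE e he).1 heS
        · intro heR
          have he : e ∈ KE n L := by simpa using hR heR
          exact ⟨he, (hE e he).2 heR⟩
      | inr y =>
        rw [inr_mem_proj]
        constructor
        · rintro ⟨hy, hyS⟩; exact (hM y hy).1 hyS
        · intro hyR
          have hy : y ∈ box 2 L := by simpa using hR hyR
          exact ⟨hy, (hM y hy).2 hyR⟩
  rw [hfilter, KI, fibre_sum L T (p : ℝ) R (box 2 L), K, Finset.prod_disjSum]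
  split_ifs <;> simp

end Identification


/-! ### `Θ_L(p, 0)` is plain percolation: `Θ_L(p, 0) ≥ θ_{ℋ_n}(o, p)` -/

section Bridge

variable [NeZero n]

open Classical in
/-- At `s = 0` only mark-free configurations count: `Θ_L(p, 0) = Σ_{S ⊆ E_L, 𝓔_L(S, ∅)} ∏ w_e(S)`.
[cite: MartineauSevero2019, §6 ("θ(p₀, 0)")] -/
theorem theta_zero_eq_sum (L : ℕ) (p : ℝ) :
    Theta n L p 0 = ∑ S ∈ (KE n L).powerset,
      if Reaches L (↑S : Set (Sym2 (Vert n))) ∅ then ∏ e ∈ KE n L, ProdWeight.gwt (fun _ => p) S e else 0 := by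
  unfold Theta ProdWeight.gTheta ProdWeight.gW
  set ι : Sym2 (Vert n) ↪ Coord n := Function.Embedding.inl with hι
  have hιmem : ∀ (S : Finset (Sym2 (Vert n))) (e : Sym2 (Vert n)), (Sum.inl e : Coord n) ∈ S.map ι ↔ e ∈ S := by
    intro S e
    rw [hι]
    simp
  have hιmem' : ∀ (S : Finset (Sym2 (Vert n))) (y : Site 2), (Sum.inr y : Coord n) ∉ S.map ι := by
    intro S y h
    rw [hι] at h
    simp at h
  -- configurations with a mark coordinate have weight zero
  rw [← Finset.sum_filter_add_sum_filter_not (K n L).powerset (fun S => ∀ c ∈ S, Sum.isLeft c)]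
  have hzero : ∑ S ∈ (K n L).powerset.filter (fun S => ¬ ∀ c ∈ S, Sum.isLeft c),
      (if (↑S : Set (Coord n)) ∈ ev L then ∏ i ∈ K n L, ProdWeight.gwt (par p 0) S i else 0) = 0 := by
    refine Finset.sum_eq_zero fun S hS => ?_
    obtain ⟨hS, hnot⟩ := Finset.mem_filter.1 hS
    obtain ⟨c, hc, hcl⟩ : ∃ c ∈ S, ¬ Sum.isLeft c := by
      by_contra h
      exact hnot fun c hc => by_contra fun h' => h ⟨c, hc, h'⟩
    cases c with
    | inl e => simp at hcl
    | inr y =>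
      have hy : (Sum.inr y : Coord n) ∈ K n L := Finset.mem_powerset.1 hS hc
      have : ∏ i ∈ K n L, ProdWeight.gwt (par p 0) S i = 0 :=
        Finset.prod_eq_zero hy (by simp [ProdWeight.gwt, hc, par])
      simp [this]
  rw [hzero, add_zero]
  -- reindex the mark-free configurations by subsets of `E_L`
  symm
  refine Finset.sum_nbij' (fun S : Finset (Sym2 (Vert n)) => S.map ι)
    (fun S : Finset (Coord n) => S.toLeft) ?_ ?_ ?_ ?_ ?_
  · intro S hS
    rw [Finset.mem_powerset] at hS
    refine Finset.mem_filter.2 ⟨Finset.mem_powerset.2 fun c hc => ?_, fun c hc => ?_⟩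
    · obtain ⟨e, he, rfl⟩ := Finset.mem_map.1 hc
      exact inl_mem_K.2 (hS he)
    · obtain ⟨e, -, rfl⟩ := Finset.mem_map.1 hc
      rfl
  · intro S hS
    obtain ⟨hS, -⟩ := Finset.mem_filter.1 hS
    rw [Finset.mem_powerset] at hS ⊢
    intro e he
    rw [Finset.mem_toLeft] at he
    exact inl_mem_K.1 (hS he)
  · intro S _
    ext e
    rw [Finset.mem_toLeft, hιmem]
  · intro S hS
    obtain ⟨-, hleft⟩ := Finset.mem_filter.1 hS
    ext c
    cases c with
    | inl e => rw [hιmem, Finset.mem_toLeft]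
    | inr y =>
      constructor
      · intro h; exact absurd h (hιmem' _ y)
      · intro h; simpa using hleft _ h
  · intro S hS
    -- same indicator, same weight
    have hev : ((↑(S.map ι) : Set (Coord n)) ∈ ev L) ↔ Reaches L (↑S : Set (Sym2 (Vert n))) ∅ := by
      simp only [ev, Set.mem_setOf_eq]
      have h1 : Sum.inl ⁻¹' (↑(S.map ι) : Set (Coord n)) = ↑S := by
        ext e
        rw [Set.mem_preimage, Finset.mem_coe, Finset.mem_coe, hιmem]
      have h2 : Sum.inr ⁻¹' (↑(S.map ι) : Set (Coord n)) = (∅ : Set (Site 2)) := by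
        ext y
        simp only [Set.mem_preimage, Finset.mem_coe, Set.mem_empty_iff_false, iff_false]
        exact hιmem' S y
      rw [h1, h2]
    have hw : ∏ i ∈ K n L, ProdWeight.gwt (par p 0) (S.map ι) i =
        ∏ e ∈ KE n L, ProdWeight.gwt (fun _ => p) S e := by
      rw [K, Finset.prod_disjSum]
      have h2 : ∏ y ∈ box 2 L, ProdWeight.gwt (par p 0) (S.map ι) (Sum.inr y : Coord n) = 1 :=
        Finset.prod_eq_one fun y _ => by simp [ProdWeight.gwt, par, hιmem']
      rw [h2, mul_one]
      refine Finset.prod_congr rfl fun e _ => ?_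
      simp [ProdWeight.gwt, par, hιmem]
    by_cases hR : Reaches L (↑S : Set (Sym2 (Vert n))) ∅
    · rw [if_pos hR, if_pos (hev.2 hR), hw]
    · rw [if_neg hR, if_neg (fun h => hR (hev.1 h))]

/-- The plain event `𝓔_L(ω, ∅)` is determined by `E_L`. [cite: MartineauSevero2019, §6] -/
theorem determinedBy_reaches_empty (hn : n ≠ 1) (L : ℕ) :
    DeterminedBy {ω : Set (Sym2 (Vert n)) | Reaches L ω ∅} (↑(KE n L) : Set (Sym2 (Vert n))) := by
  rw [determinedBy_iff]
  have key : ∀ ω ω' : Set (Sym2 (Vert n)), ω ∩ ↑(KE n L) = ω' ∩ ↑(KE n L) → Reaches L ω ∅ → Reaches L ω' ∅ := by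
    intro ω ω' h hR
    refine hR.congr hn (fun e he heω => ?_) (fun y _ hy => hy)
    exact ((Set.ext_iff.1 h e).1 ⟨heω, (mem_KE_iff_mem_EL hn).2 he⟩).1
  exact fun ω ω' h => ⟨key ω ω' h, key ω' ω h.symm⟩

/-- **`Θ_L(p, 0) = P_p^{ℋ_n}(𝓔_L(ω, ∅))`**: at `s = 0` the column model is Bernoulli bond percolation on
`ℋ_n`. [cite: MartineauSevero2019, §6 ("θ(p₀, 0)")] -/
theorem measureReal_reaches_empty (hn : n ≠ 1) (L : ℕ) (p : unitInterval) :
    (bondPercolation (slabTorusGraph n) p).real {ω | Reaches L ω ∅} = Theta n L p 0 := by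
  classical
  rw [bondPercolation, Russo.measureReal_eq_cylPoly (determinedBy_reaches_empty (n := n) hn L), theta_zero_eq_sum]
  unfold Russo.cylPoly
  refine Finset.sum_congr rfl fun S hS => ?_
  simp only [Set.mem_setOf_eq]
  split_ifs
  · refine Finset.prod_congr rfl fun e he => ?_
    simp [Russo.weight, ProdWeight.gwt, mem_edgeSet_of_mem_KE hn he]
  · rfl

omit [NeZero n] in
/-- An open path from the origin inside `ℋ_n` either stays among columns of sup-norm `≤ L` (and then
its endpoint is in the plain cluster `Cl_L(ω, ∅)`) or produces a vertex of the plain cluster in a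
column of sup-norm exactly `L + 1`. [folklore] -/
theorem walk_reaches {L : ℕ} {ω : Set (Sym2 (Vert n))} (hω : ω ⊆ (slabTorusGraph n).edgeSet)
    {u v : Vert n} (w : (openGraph ω).Walk u v) (hu : InCl L ω ∅ u) (huL : pnorm u.2 ≤ L) :
    (∃ x : Vert n, InCl L ω ∅ x ∧ pnorm x.2 = L + 1) ∨ (InCl L ω ∅ v ∧ pnorm v.2 ≤ L) := by
  induction w with
  | nil => exact Or.inr ⟨hu, huL⟩
  | @cons a b c hab _ ih =>
    rw [openGraph_adj] at hab
    have hadj : (slabTorusGraph n).Adj a b := hω hab.1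
    have hb : InCl L ω ∅ b := InCl.edge hu hadj hab.1 (Or.inl huL)
    have hbL : pnorm b.2 ≤ L + 1 := (pnorm_le_succ_of_adj_vert hadj).trans (by omega)
    rcases Nat.lt_or_ge (pnorm b.2) (L + 1) with h | h
    · exact ih hb (by omega)
    · exact Or.inl ⟨b, hb, le_antisymm hbL h⟩

/-- **`θ_{ℋ_n}(o, p) ≤ Θ_L(p, 0)`**: an infinite open cluster of the origin leaves the finite set of
columns of sup-norm `≤ L`, hence (following an open path) contains a vertex of `Cl_L(ω, ∅)` in a
column of sup-norm `L + 1`. [cite: MartineauSevero2019, §6 ("θ(𝐩(0), 𝐬(0)) ≥ θ(p₀, 0) > 0")] -/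
theorem theta_le_theta_zero (hn : n ≠ 1) (L : ℕ) (p : unitInterval) :
    theta (slabTorusGraph n) (origin n) p ≤ Theta n L p 0 := by
  classical
  rw [← measureReal_reaches_empty hn L p]
  set μ := bondPercolation (slabTorusGraph n) p with hμ
  set bad : Set (BondConfig (Vert n)) := {ω | ¬ ω ⊆ (slabTorusGraph n).edgeSet} with hbad
  have hsub : (percolatesAt (origin n) : Set (BondConfig (Vert n))) ⊆ {ω | Reaches L ω ∅} ∪ bad := by
    intro ω hω
    by_cases hωE : ω ⊆ (slabTorusGraph n).edgeSet
    · left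
      -- the cluster is infinite, the columns of sup-norm `≤ L` are finitely many
      have hinf : (openCluster ω (origin n)).Infinite := hω
      obtain ⟨v, hv, hvF⟩ := hinf.exists_notMem_finset ((Finset.univ : Finset (ZMod n)) ×ˢ box 2 L)
      have hvL : ¬ pnorm v.2 ≤ L := fun h => hvF (Finset.mem_product.2 ⟨Finset.mem_univ _, mem_box_iff_pnorm_le.2 h⟩)
      obtain ⟨w⟩ := (hv : (openGraph ω).Reachable (origin n) v)
      rcases walk_reaches hωE w InCl.origin (by simp [origin]) with ⟨x, hx, hxL⟩ | ⟨-, h⟩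
      · exact ⟨x, hx, hxL⟩
      · exact absurd h hvL
    · exact Or.inr hωE
  have hbad0 : μ.real bad = 0 := by
    rw [measureReal_eq_zero_iff]
    have := ProbabilityTheory.setBernoulli_ae_subset (u := (slabTorusGraph n).edgeSet) (p := p)
    rw [Filter.Eventually, mem_ae_iff, Set.compl_setOf] at this
    exact this
  calc theta (slabTorusGraph n) (origin n) p = μ.real (percolatesAt (origin n)) := rfl
    _ ≤ μ.real ({ω | Reaches L ω ∅} ∪ bad) := measureReal_mono hsub
    _ ≤ μ.real {ω | Reaches L ω ∅} + μ.real bad := measureReal_union_le _ _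
    _ = μ.real {ω | Reaches L ω ∅} := by rw [hbad0, add_zero]

/-- **The `ℋ`-side probability of the transcript event is `Θ_L(p, p^T)`** (for `k` past the halting
time). [cite: MartineauSevero2019, §5 (Step ∞)] -/
theorem measureReal_reachState_I (hn : n ≠ 1) (L T k : ℕ) (hk : (KE n L).card + (box 2 L).card < k)
    (p : unitInterval) :
    (bondPercolation (GI n T) p).real
      {ω | ReachState L (stateOf (n := n) L (bt ((texpl L (encI (n := n) T)).hist k ω)))} = Theta n L p ((p : ℝ) ^ T) := by
  rw [setOf_reachState_eq hn L T k hk, measureReal_decode_ev L T hn p]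

end Bridge

end SlabTorus

end Literature.Probability.Percolation
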